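import Literature.Computability.Complexity.ProbabilisticClasses
import Literature.Computability.Complexity.ClockedUniversalAcceptance
import Literature.Computability.Complexity.CoinCounting
import Literature.Computability.Complexity.PolyTimeCountable
import Literature.Computability.Complexity.CookReducibilityTransitive
import Literature.Computability.Complexity.StringEquality
import HarnessLib

/-!
# Zero-error expected polynomial time is contained in `ZPP = RP ∩ coRP`, from clocked universal
# acceptance testing

Sibling proof file of `ProbabilisticClasses.lean` (D-0014) for the `←` direction of the named
fact `mem_ZPP_iff_expectedTime` — Gill 1977, Def. 5.1(iii) ("`ZPP` is the class of languages
recognized by PTMs with polynomial bounded average run time and zero error probability") and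
Prop. 5.5(iii) [Rabin] ("`L` is in `ZPP` iff both `L` and `L̄` are in `VPP`", proof omitted
there); Arora–Barak 2009, Def. 7.7 and Thm. 7.8 (`ZPP = RP ∩ coRP`, proof left as Exercise
7.6) with §7.4.2 ("expected running time versus worst-case running time": add a counter, halt
after too many steps, Markov's inequality).

In the tree's model (`RandAlg.RunsInExpectedTime`: a machine `M` outputs `[A.run x r]` on the
pair `⟨x, r⟩` within `τ x r` steps and the mean of `τ x ·` over `{0,1}^{q(n)}` is `≤ p(n)`; zero
error: `A.run x r = [x ∈ L]` for EVERY coin string of the prescribed length) the printed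
argument needs exactly one machine-level ingredient, the clocked simulation "run `M` for
`2 p(n)` steps and accept iff it has accepted", which is the named fact
`clockedUniversalAcceptance` (`ClockedUniversalAcceptance.lean`: an acceptance language `U ∈ P`,
complete and sound for every `Turing.TM2ComputableAux Bool Bool` with a polynomial overhead).
This file PROVES

* `ZPPExpected.mem_RP_of_clockedTest` — the one-sided half: if a machine `N` answers `[f x r]` on
  `⟨x, r⟩` within `τ x r` steps, mean `≤ T(n)`, and `f x r = 1 ↔ x ∈ S` on coin strings of length
  `q(n)`, then `S ∈ RP` with the witness `{w | ⟨e, ⟨w, 1^{P(2T(n))}⟩⟩ ∈ U} ∈ P` (a polynomial-time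
  preimage of `U`): by Markov at least half of the coin strings have `τ x r ≤ 2 T(n)` and are
  accepted by completeness of `U`; on `x ∉ S` soundness of `U` and uniqueness of the output word
  of a deterministic machine (`TM2Std.outputs_unique`) exclude false positives;
* `mem_ZPP_of_expectedTime_of_clockedUniversalAcceptance` — **`clockedUniversalAcceptance →`
  (machine form) `→ L ∈ ZPP`**: the `RP` half with `M` itself, the `coRP` half with `M` followed
  by the bit flip `[b] ↦ [¬b]` (`Turing.TM2ComputableAux.comp`, additive running time, so the mean
  grows by a constant).

The converse direction (a Las Vegas machine for `L ∈ RP ∩ coRP`) is machine programming proper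
and lives in the sequel; the assembly `mem_ZPP_iff_expectedTime_holds` follows both.

## References

* J. Gill, *Computational complexity of probabilistic Turing machines*, SIAM J. Comput. 6 (1977)
  675–695, Def. 5.1(iii) (p. 685), Prop. 5.2(i) (proof: "simulating `M` for up to `c p(n)`
  steps … `M` requires more than `c p(n)` steps with probability less than `1/c`"), Def. 5.4,
  Prop. 5.5(iii). doi:10.1137/0206049 [Gill1977]
* S. Arora, B. Barak, *Computational Complexity: A Modern Approach*, CUP 2009, Def. 7.7,
  Thm. 7.8, §7.4.2, Thm. 1.9 / §1.4.1 (universal TM with time bound). [AroraBarakCC2009]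
-/

namespace Literature.Computability.Complexity

open _root_.Computability Turing Polynomial

namespace ZPPExpected

/-! ### Counting: Markov's inequality over the coin strings -/

/-- `cnt` is monotone in the event (on strings of length `m`). (Twin of
`GapMINKTDecision.cnt_mono` in `MetaComplexity/GapMINKTSearchProofs.lean`, which imports this
directory and so cannot be imported here.) [folklore] -/
theorem cnt_mono {m : ℕ} {E E' : Set (List Bool)}
    (h : ∀ y : List Bool, y.length = m → y ∈ E → y ∈ E') : cnt m E ≤ cnt m E' := by
  classical
  unfold cnt
  refine Finset.card_le_card fun r hr => ?_
  simp only [Finset.mem_filter, Finset.mem_univ, true_and] at hr ⊢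
  exact h _ r.toList_length hr

/-- `1/2 ≤ uniformProb m E` as an integer inequality: `2^m ≤ 2 · cnt m E`. [folklore] -/
theorem half_le_uniformProb_of_le {m : ℕ} {E : Set (List Bool)} (h : 2 ^ m ≤ 2 * cnt m E) :
    1 / 2 ≤ uniformProb m E := by
  rw [uniformProb_eq_cnt_div, le_div_iff₀ (by positivity)]
  have h' : ((2 ^ m : ℕ) : ℝ) ≤ ((2 * cnt m E : ℕ) : ℝ) := by exact_mod_cast h
  push_cast at h'
  linarith

/-- `cnt` as the cardinality of a filter, for any decidability instance. [folklore] -/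
theorem cnt_eq_card_filter {m : ℕ} (E : Set (List Bool))
    [DecidablePred fun r : List.Vector Bool m => r.toList ∈ E] :
    cnt m E = (Finset.univ.filter fun r : List.Vector Bool m => r.toList ∈ E).card := by
  unfold cnt
  congr 1
  exact Finset.filter_congr_decidable _ _ _

/-- **Markov's inequality, counting form**: if the mean of `τ` over `{0,1}^m` is at most `T`,
then at least half of the strings have `τ ≤ 2T`. (With the integer slack `2T + 1` on the bad
strings this holds for `T = 0` as well.) [cite: AroraBarakCC2009, §7.4.2 and Lemma A.7] -/
theorem two_pow_le_two_mul_cnt_of_mean_le {m : ℕ} (τ : List Bool → ℕ) (T : ℕ)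
    (h : (∑ r : List.Vector Bool m, (τ r.toList : ℝ)) / 2 ^ m ≤ T) :
    2 ^ m ≤ 2 * cnt m {r | τ r ≤ 2 * T} := by
  classical
  have hsum : (∑ r : List.Vector Bool m, (τ r.toList : ℝ)) ≤ 2 ^ m * T := by
    rwa [div_le_iff₀ (by positivity), mul_comm] at h
  -- the bad strings take at least `2T + 1` steps each
  have hbad : ((cnt m {r | τ r ≤ 2 * T}ᶜ : ℕ) : ℝ) * (2 * T + 1) ≤
      ∑ r : List.Vector Bool m, (τ r.toList : ℝ) := by
    rw [cnt_eq_card_filter]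
    set bad := Finset.univ.filter fun r : List.Vector Bool m =>
      r.toList ∈ ({r : List Bool | τ r ≤ 2 * T}ᶜ : Set (List Bool)) with hbad
    calc (bad.card : ℝ) * (2 * T + 1) = ∑ _r ∈ bad, ((2 * T + 1 : ℕ) : ℝ) := by
          rw [Finset.sum_const, nsmul_eq_mul]; push_cast; ring
      _ ≤ ∑ r ∈ bad, (τ r.toList : ℝ) := Finset.sum_le_sum fun r hr => by
          have hr' : ¬ τ r.toList ≤ 2 * T := by
            have := (Finset.mem_filter.1 hr).2
            simpa using this
          exact_mod_cast (by omega : 2 * T + 1 ≤ τ r.toList)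
      _ ≤ ∑ r : List.Vector Bool m, (τ r.toList : ℝ) :=
          Finset.sum_le_univ_sum_of_nonneg fun _ => by positivity
  have hbad2 : 2 * cnt m {r | τ r ≤ 2 * T}ᶜ ≤ 2 ^ m := by
    have h0 : (0 : ℝ) ≤ 2 ^ m := by positivity
    have h1 : ((cnt m {r | τ r ≤ 2 * T}ᶜ : ℕ) : ℝ) * (2 * T + 1) ≤ 2 ^ m * T := hbad.trans hsum
    have h2 : ((2 * cnt m {r | τ r ≤ 2 * T}ᶜ : ℕ) : ℝ) * (2 * T + 1) ≤ 2 ^ m * (2 * T + 1) := by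
      push_cast
      calc (2 : ℝ) * (cnt m {r | τ r ≤ 2 * T}ᶜ : ℕ) * (2 * T + 1)
          = 2 * (((cnt m {r | τ r ≤ 2 * T}ᶜ : ℕ) : ℝ) * (2 * T + 1)) := by ring
        _ ≤ 2 * (2 ^ m * T) := by linarith
        _ ≤ 2 ^ m * (2 * T + 1) := by nlinarith
    have h3 : ((2 * cnt m {r | τ r ≤ 2 * T}ᶜ : ℕ) : ℝ) ≤ 2 ^ m :=
      le_of_mul_le_mul_right h2 (by positivity)
    exact_mod_cast h3
  have hcompl := cnt_add_cnt_compl m {r | τ r ≤ 2 * T}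
  omega

/-! ### Uniqueness of outputs and the bit flip -/

/-- A deterministic machine has at most one output word on a given input (the `OutputsWithin`
form of `TM2Std.outputs_unique`; twin of `AvM.outputsWithin_unique` in
`AaronsonVanMelkebeek2011Proofs.lean`, not imported so as to keep circuits and advice classes
out of the import closure of the probabilistic classes). [folklore] -/
theorem outputsWithin_unique {Γ₀ Γ₁ : Type} (M : TM2ComputableAux Γ₀ Γ₁) {l : List Γ₀}
    {l₁ l₂ : List Γ₁} {m₁ m₂ : ℕ} (h₁ : M.OutputsWithin l l₁ m₁) (h₂ : M.OutputsWithin l l₂ m₂) :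
    l₁ = l₂ :=
  List.map_injective_iff.2 M.outputAlphabet.symm.injective (TM2Std.outputs_unique M.tm h₁ h₂)

/-- The bit flip on one-symbol words, as a total string function: `notWordFn w = [w ≠ [0]]`…
precisely `[decide (w = [false])]`, so `notWordFn [b] = [¬b]`. [folklore] -/
noncomputable def notWordFn : List Bool → List Bool :=
  eqPairFn ∘ fanoutFn id fun _ => [false]

/-- `notWordFn [b] = [!b]`. [folklore] -/
theorem notWordFn_singleton (b : Bool) : notWordFn [b] = [!b] := by
  simp only [notWordFn, Function.comp_apply, fanoutFn_apply, id, eqPairFn_boolPair]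
  cases b <;> rfl

/-- `notWordFn ∈ FP`. [folklore] -/
theorem notWordFn_mem_FP : notWordFn ∈ FP :=
  comp_mem_FP eqPairFn_mem_FP (fanoutFn_mem_FP (PolyTimeComputable.id _) (const_mem_FP _))

/-- **A bit-flipping post-processor**: a machine `G` and a constant `c` with
`G.OutputsWithin [b] [¬b] c` for both bits. [folklore] -/
theorem exists_notMachine :
    ∃ (G : TM2ComputableAux Bool Bool) (c : ℕ), ∀ b : Bool, G.OutputsWithin [b] [!b] c := by
  obtain ⟨p, G, hG⟩ := notWordFn_mem_FP
  refine ⟨G, p.eval 1, fun b => ?_⟩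
  simpa [notWordFn_singleton] using hG [b]

/-! ### The padding map into the acceptance language -/

/-- The query map `w ↦ ⟨e, ⟨w, 1^{P(|x|)}⟩⟩` for `x = (boolUnpair w).1` (so `x` itself on
`w = ⟨x, r⟩`). [cite: AroraBarakCC2009, Thm. 1.9 and §1.4.1] -/
noncomputable def queryFn (e : List Bool) (P : Polynomial ℕ) : List Bool → List Bool :=
  fanoutFn (fun _ => e) (fanoutFn id (OracleCompose.padFn P))

/-- Value of the query map on a pair. [folklore] -/
theorem queryFn_boolPair (e : List Bool) (P : Polynomial ℕ) (x r : List Bool) :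
    queryFn e P (boolPair x r) =
      boolPair e (boolPair (boolPair x r) (List.replicate (P.eval x.length) true)) := by
  simp [queryFn, OracleCompose.padFn_apply]

/-- The query map is polynomial time. [cite: AroraBarakCC2009, Thm. 2.8 (proof)] -/
theorem queryFn_mem_FP (e : List Bool) (P : Polynomial ℕ) : queryFn e P ∈ FP :=
  fanoutFn_mem_FP (const_mem_FP _)
    (fanoutFn_mem_FP (PolyTimeComputable.id _) (OracleCompose.padFn_mem_FP P))

/-- The witness language `{w | ⟨e, ⟨w, 1^{P(|x|)}⟩⟩ ∈ U}` (a `Language`, so that memberships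
below use the `Language` instance, as in `rp`). [cite: AroraBarakCC2009, §7.4.2] -/
noncomputable def rpWitness (e : List Bool) (P : Polynomial ℕ) (U : Language Bool) :
    Language Bool :=
  queryFn e P ⁻¹' U

/-- Membership in the witness language. [folklore] -/
theorem mem_rpWitness {e : List Bool} {P : Polynomial ℕ} {U : Language Bool} {w : List Bool} :
    w ∈ rpWitness e P U ↔ queryFn e P w ∈ U :=
  Iff.rfl

/-- The witness language is in `P` (a polynomial-time preimage of `U ∈ P`).
[cite: AroraBarakCC2009, Thm. 2.8 (proof)] -/
theorem rpWitness_mem_P (e : List Bool) (P : Polynomial ℕ) {U : Language Bool}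
    (hU : U ∈ Classes.P) : rpWitness e P U ∈ Classes.P :=
  preimage_mem_P hU (queryFn_mem_FP e P)

/-! ### The one-sided half -/

/-- **One-sided witnesses from a clocked acceptance test** (Gill 1977, proof of Prop. 5.2(i);
Arora–Barak 2009, §7.4.2). Let `U` be an acceptance language, complete with overhead `P` and
sound for the machine `N` under the code `e`. If `N` answers the one-bit word `[f x r]` on
`⟨x, r⟩` within `τ x r` steps for every coin string `r` of length `q(|x|)`, the mean of `τ x ·`
is at most `T(|x|)`, and `f x r = 1 ↔ x ∈ S` on those coin strings (zero error), then `S ∈ RP`: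
the witness language `{w | ⟨e, ⟨w, 1^{P(2T(|x|))}⟩⟩ ∈ U}` is in `P`; for `x ∈ S` the coin strings
with `τ x r ≤ 2T` — at least half of them, by Markov — are accepted (completeness), and for
`x ∉ S` an accepted coin string would make `N` output both `[1]` (soundness) and `[0]`.
[cite: Gill1977, Prop. 5.2(i) (proof) and Prop. 5.5(iii)] [cite: AroraBarakCC2009, §7.4.2] -/
theorem mem_RP_of_clockedTest {U : Language Bool} (hU : U ∈ Classes.P)
    {N : TM2ComputableAux Bool Bool} {e : List Bool} {P : Polynomial ℕ}
    (hcomp : ∀ (w : List Bool) (t Nb : ℕ), N.OutputsWithin w [true] t → P.eval t ≤ Nb →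
      boolPair e (boolPair w (List.replicate Nb true)) ∈ U)
    (hsound : ∀ (w : List Bool) (Nb : ℕ), boolPair e (boolPair w (List.replicate Nb true)) ∈ U →
      ∃ t : ℕ, N.OutputsWithin w [true] t)
    {S : Language Bool} {q T : Polynomial ℕ} {f : List Bool → List Bool → Bool}
    {τ : List Bool → List Bool → ℕ}
    (hrun : ∀ x r : List Bool, r.length = q.eval x.length →
      N.OutputsWithin (boolPair x r) [f x r] (τ x r))
    (havg : ∀ x : List Bool, (∑ r : List.Vector Bool (q.eval x.length), (τ x r.toList : ℝ)) /
      2 ^ (q.eval x.length) ≤ ((T.eval x.length : ℕ) : ℝ))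
    (hf : ∀ x r : List Bool, r.length = q.eval x.length → (f x r = true ↔ x ∈ S)) :
    S ∈ RP := by
  have hmem : ∀ x r : List Bool, boolPair x r ∈ rpWitness e (P.comp (2 * T)) U ↔
      boolPair e (boolPair (boolPair x r)
        (List.replicate (P.eval (2 * T.eval x.length)) true)) ∈ U := by
    intro x r
    rw [mem_rpWitness, queryFn_boolPair, eval_comp, eval_mul, eval_ofNat]
  refine ⟨rpWitness e (P.comp (2 * T)) U, rpWitness_mem_P e _ hU, q,
    fun x => ⟨fun hx => ?_, fun hx r hr hrL => ?_⟩⟩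
  · -- completeness + Markov: at least half of the coin strings halt in time and are accepted
    have hmark := two_pow_le_two_mul_cnt_of_mean_le (τ x) (T.eval x.length) (havg x)
    refine half_le_uniformProb_of_le (hmark.trans (Nat.mul_le_mul_left 2 (cnt_mono ?_)))
    intro r hr hτ
    replace hτ : τ x r ≤ 2 * T.eval x.length := hτ
    rw [Set.mem_setOf_eq, hmem]
    have hout : N.OutputsWithin (boolPair x r) [true] (2 * T.eval x.length) := by
      have h := hrun x r hr
      rw [(hf x r hr).2 hx] at h
      exact h.mono hτ
    exact hcomp _ _ _ hout le_rfl
  · -- soundness + uniqueness of outputs: no false positives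
    rw [hmem] at hrL
    obtain ⟨t, ht⟩ := hsound _ _ hrL
    have heq := outputsWithin_unique N ht (hrun x r hr)
    have hfx : f x r = true := (List.head_eq_of_cons_eq heq).symm
    exact hx ((hf x r hr).1 hfx)

end ZPPExpected

open ZPPExpected

/-- **Zero-error expected polynomial time `⊆ ZPP`, from clocked universal acceptance testing**
(the `←` direction of `mem_ZPP_iff_expectedTime`; Gill 1977, Def. 5.1(iii) with Prop. 5.5(iii),
whose omitted proof is that of Prop. 5.2(i): "let `M'` be a PTM that recognizes `L` by simulating
`M` for up to `c p(n)` steps … since `M` requires more than `c p(n)` steps with probability less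
than `1/c`"; Arora–Barak 2009, Thm. 7.8 with §7.4.2). Given `A : RandAlg (List Bool) Bool` with
an exactly polynomial coin budget `q`, a machine `M` answering `[A.run x r]` on `⟨x, r⟩` within
`τ x r` steps of mean `≤ p(n)`, and zero error on every coin string of length `q(n)`:
`L ∈ RP` by `mem_RP_of_clockedTest` for `M`, and `Lᶜ ∈ RP` by the same lemma for `M` followed
by the bit flip (`exists_notMachine`, `Turing.TM2ComputableAux.comp_outputsWithin`: running time
`τ x r + c`, mean `≤ p(n) + c`), i.e. `L ∈ coRP`; hence `L ∈ ZPP = RP ∩ coRP`. The clocked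
simulation is the hypothesis `clockedUniversalAcceptance` (Arora–Barak 2009, Thm. 1.9/§1.4.1).
[cite: Gill1977, Def. 5.1(iii) and Prop. 5.5(iii)] [cite: AroraBarakCC2009, Thm. 7.8 and §7.4.2] -/
theorem mem_ZPP_of_expectedTime_of_clockedUniversalAcceptance (hcl : clockedUniversalAcceptance)
    {L : Language Bool} (A : RandAlg (List Bool) Bool)
    (hA : ∃ p q : Polynomial ℕ,
      A.RunsInExpectedTime id encodeBool (fun x => ((p.eval x.length : ℕ) : ℝ)) ∧
        ∀ n, A.coinLen n = q.eval n)
    (hzero : ∀ (x : List Bool) (r : List Bool), r.length = A.coinLen x.length →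
      A.run x r = L.boolIndicator x) :
    L ∈ ZPP := by
  obtain ⟨U, hU, huniv⟩ := hcl
  obtain ⟨p, q, ⟨M, τ, hrun, havg⟩, hq⟩ := hA
  -- the data of `RunsInExpectedTime`, with the coin budget rewritten as the polynomial `q`
  have hrun' : ∀ x r : List Bool, r.length = q.eval x.length →
      M.OutputsWithin (boolPair x r) [A.run x r] (τ x r) := by
    intro x r hr
    rw [← hq] at hr
    exact hrun x r hr
  have havg' : ∀ x : List Bool, (∑ r : List.Vector Bool (q.eval x.length), (τ x r.toList : ℝ)) /
      2 ^ (q.eval x.length) ≤ ((p.eval x.length : ℕ) : ℝ) := by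
    intro x
    have key : ∀ m : ℕ, m = A.coinLen x.length →
        (∑ r : List.Vector Bool m, (τ x r.toList : ℝ)) / 2 ^ m ≤ ((p.eval x.length : ℕ) : ℝ) := by
      rintro m rfl
      exact havg x
    exact key _ (hq _).symm
  have hind : ∀ x r : List Bool, r.length = q.eval x.length →
      (A.run x r = true ↔ x ∈ L) := by
    intro x r hr
    rw [← hq] at hr
    rw [hzero x r hr]
    exact (Set.mem_iff_boolIndicator L x).symm
  refine ⟨?_, ?_⟩
  · -- `L ∈ RP`
    obtain ⟨e, P, hcomp, hsound⟩ := huniv M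
    exact mem_RP_of_clockedTest hU hcomp hsound hrun' havg' hind
  · -- `Lᶜ ∈ RP`, with the bit-flipped machine
    obtain ⟨G, c, hG⟩ := exists_notMachine
    obtain ⟨e, P, hcomp, hsound⟩ := huniv (M.comp G)
    change Lᶜ ∈ RP
    refine mem_RP_of_clockedTest hU hcomp hsound (q := q) (T := p + Polynomial.C c)
      (f := fun x r => !A.run x r) (τ := fun x r => c + τ x r) ?_ ?_ ?_
    · intro x r hr
      exact TM2ComputableAux.comp_outputsWithin M G (hrun' x r hr) (hG _)
    · intro x
      have h := havg' x
      have hpos : (0 : ℝ) < 2 ^ (q.eval x.length) := by positivity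
      rw [div_le_iff₀ hpos] at h ⊢
      rw [eval_add, eval_C]
      simp only [Nat.cast_add, Finset.sum_add_distrib, Finset.sum_const, Finset.card_univ,
        card_vector, Fintype.card_bool, nsmul_eq_mul, Nat.cast_pow, Nat.cast_ofNat] at h ⊢
      nlinarith [h, hpos]
    · intro x r hr
      have h1 := hind x r hr
      change (!A.run x r) = true ↔ x ∉ L
      cases hb : A.run x r with
      | false =>
        rw [hb] at h1
        exact ⟨fun _ hx => Bool.false_ne_true (h1.2 hx), fun _ => rfl⟩
      | true =>
        rw [hb] at h1
        exact ⟨fun h => absurd h (by decide), fun hx => absurd (h1.1 rfl) hx⟩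

end Literature.Computability.Complexity
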